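import Mathlib
import Literature.Barriers.ValiantsHypothesis.AlgebraicNaturalProofs
import Literature.Computability.AlgebraicComplexity.RazUniversalCircuits
import Literature.Computability.AlgebraicComplexity.ValiantClasses
import Literature.Computability.AlgebraicComplexity.ArithCircuitProofs
import Literature.Computability.AlgebraicComplexity.RazElusiveGeneralDefinable
import Literature.Computability.AlgebraicComplexity.VNPeEqVNP
import Summits.ValiantsHypothesis.ValiantsHypothesis.Theorems.BarrierLeverDefinableEquationsDefs

/-!
# Crux `BarrierLever.DefinableEquations` (stmt-ValiantsHypothesis-8745), line `registered`
(raz-tableau) — registered stub `stub_combClosure` (V5): LINEAR CLOSURE OF VALIANT WITNESSES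

**Claim settled** (TRUE, generic bookkeeping): if every tableau datum `τ i` (`i < k ≤ B`,
`(τ i).D ≤ B`) has a Valiant-criterion witness `H_i` on its own Boolean block
`Fin ((τ i).D · n · n)` with `boolSum H_i = (τ i).poly`, `L(H_i) ≤ P¹⁴ N`, `deg H_i ≤ P⁶`
(`P = B + n + 2`, `N = C(2n, n)`), then the short combination `combPoly τ c = Σ_i c_i (τ i).poly`,
renamed into the crux's variables `degLEMonomials n ⊇ topMonomials n`, is `boolSum H` for an `H`
on the COMMON Boolean block `Fin (B · n · n)` with `L(H) ≤ P¹⁷ N` and `deg H ≤ P⁷`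
(`combWitnessSpec`).

Proof.  (1) PADDING a Boolean block `Fin a ↪ Fin b` (`a ≤ b`, `b = a + d`): multiply by the
product of the `d` new Boolean variables (the tree's `RazDefinable.padWitness`: only the all-`true`
assignment of the new variables survives, `boolSum_padWitness`), flatten the nested block
`(σ ⊕ Fin a) ⊕ Fin d ≃ σ ⊕ Fin (a + d)` (`boolSum_boolSum`); cost `≤ L + b + 1`, degree `≤ deg + b`.
(2) LINEARITY: `H := Σ_i C (c i) · rename (Sum.map (topIncl n) id) (pad H_i)`; `boolSum` is a finite
sum of algebra-map evaluations, hence additive and `C`-linear, and commutes with renaming the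
polynomial variables (`boolSum_rename_sumMap`).  (3) ARITHMETIC: `L(H) ≤ k (P¹⁴ N + B n n + 2) + k
≤ 3 P¹⁵ N ≤ P¹⁷ N` and `deg H ≤ P⁶ + B n n ≤ 2 P⁶ ≤ P⁷` (`P ≥ 2`, `N ≥ 1`, `k, B, n ≤ P`).

Unconditional (axioms `propext`, `Classical.choice`, `Quot.sound`). References: [Burgisser2000]
Def. 2.5, Rem. 2.2, Prop. 2.20 (Valiant's criterion; closure of Boolean sums under linear
combinations is folklore); [BurgisserClausenShokrollahi1997] Lemma (21.22) (nesting of Boolean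
sums).
-/

-- layout Summits/ValiantsHypothesis/ValiantsHypothesis forces the duplicated namespace component
set_option linter.dupNamespace false

noncomputable section

namespace Summit.ValiantsHypothesis.ValiantsHypothesis.Theorems.BarrierLeverDefinableEquations

open MvPolynomial Literature.Computability.AlgebraicComplexity
open Literature.Barriers.ValiantsHypothesis

namespace StubCombClosure

/-- Valiant's Boolean sum is additive over finite sums (it is a finite sum of algebra-map
evaluations). [cite: Burgisser2000, Def. 2.5] -/
theorem boolSum_finset_sum {σ ι : Type*} {m : ℕ} (s : Finset ι)
    (f : ι → MvPolynomial (σ ⊕ Fin m) ℂ) :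
    boolSum (∑ i ∈ s, f i) = ∑ i ∈ s, boolSum (f i) := by
  unfold boolSum
  simp only [map_sum]
  exact Finset.sum_comm

/-- Valiant's Boolean sum commutes with multiplication by a constant.
[cite: Burgisser2000, Def. 2.5] -/
theorem boolSum_C_mul {σ : Type*} {m : ℕ} (a : ℂ) (f : MvPolynomial (σ ⊕ Fin m) ℂ) :
    boolSum (C a * f) = C a * boolSum f := by
  unfold boolSum
  rw [Finset.mul_sum]
  refine Finset.sum_congr rfl fun e _ => ?_
  rw [map_mul, aeval_C, algebraMap_eq]

/-- **Padding a Boolean block.** For `a ≤ b`, every `F` on the Boolean block `Fin a` has a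
companion `G` on the block `Fin b` with the same Boolean sum, `L(G) ≤ L(F) + b + 1` and
`deg G ≤ deg F + b`: multiply by the product of the new Boolean variables (`padWitness`: only the
all-`true` assignment of the new block survives) and flatten the nested blocks (`boolSum_boolSum`).
[cite: BurgisserClausenShokrollahi1997, Lemma (21.22)] -/
theorem exists_pad {σ : Type*} {a b : ℕ} (h : a ≤ b) (F : MvPolynomial (σ ⊕ Fin a) ℂ) :
    ∃ G : MvPolynomial (σ ⊕ Fin b) ℂ, boolSum G = boolSum F ∧
      complexity G ≤ complexity F + b + 1 ∧ G.totalDegree ≤ F.totalDegree + b := by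
  obtain ⟨d, rfl⟩ := Nat.exists_eq_add_of_le h
  refine ⟨rename ((Equiv.sumAssoc σ (Fin a) (Fin d)).trans
      (Equiv.sumCongr (Equiv.refl σ) finSumFinEquiv)) (RazDefinable.padWitness F d), ?_, ?_, ?_⟩
  · rw [← boolSum_boolSum, RazDefinable.boolSum_padWitness]
  · refine (complexity_rename_le_holds' _ _).trans ?_
    unfold RazDefinable.padWitness
    refine (complexity_mul_le_holds _ _).trans ?_
    have h1 := complexity_rename_le_holds' (Sum.inl : σ ⊕ Fin a → (σ ⊕ Fin a) ⊕ Fin d) F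
    have h2 : complexity (∏ v : Fin d, (X (Sum.inr v) : MvPolynomial ((σ ⊕ Fin a) ⊕ Fin d) ℂ))
        ≤ d := by
      refine (complexity_finset_prod_le _ _).trans ?_
      rw [Finset.sum_eq_zero fun v _ => complexity_X_holds _, Finset.card_univ, Fintype.card_fin,
        zero_add]
    omega
  · refine (totalDegree_rename_le _ _).trans ?_
    unfold RazDefinable.padWitness
    refine (totalDegree_mul _ _).trans ?_
    have h1 := totalDegree_rename_le (Sum.inl : σ ⊕ Fin a → (σ ⊕ Fin a) ⊕ Fin d) F
    have h2 : (∏ v : Fin d, (X (Sum.inr v) : MvPolynomial ((σ ⊕ Fin a) ⊕ Fin d) ℂ)).totalDegree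
        ≤ d := by
      refine (totalDegree_finsetProd _ _).trans ?_
      simp only [totalDegree_X, Finset.sum_const, Finset.card_univ, Fintype.card_fin, smul_eq_mul,
        mul_one, le_refl]
    omega

/-- The final size arithmetic: `k (P¹⁴ N + B n n + 2) + k ≤ P¹⁷ N` for `k, B, n ≤ P`, `2 ≤ P`,
`1 ≤ N`. [folklore] -/
theorem size_arith {k B n P N : ℕ} (hk : k ≤ P) (hB : B ≤ P) (hn : n ≤ P) (h2 : 2 ≤ P)
    (hN : 1 ≤ N) : k * (P ^ 14 * N + B * n * n + 2) + k ≤ P ^ 17 * N := by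
  have hBnn : B * n * n ≤ P ^ 3 :=
    calc B * n * n ≤ P * P * P := Nat.mul_le_mul (Nat.mul_le_mul hB hn) hn
      _ = P ^ 3 := by ring
  have h3P : 3 * P ≤ P ^ 4 :=
    calc 3 * P ≤ P ^ 3 * P := Nat.mul_le_mul_right _
          ((show 3 ≤ 2 ^ 3 by norm_num).trans (Nat.pow_le_pow_left h2 3))
      _ = P ^ 4 := by ring
  have h4 : P ^ 4 ≤ P ^ 15 * N :=
    (Nat.pow_le_pow_right (by omega) (by norm_num)).trans (Nat.le_mul_of_pos_right _ hN)
  have h22 : 4 ≤ P ^ 2 := (show 4 = 2 ^ 2 by norm_num).le.trans (Nat.pow_le_pow_left h2 2)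
  calc k * (P ^ 14 * N + B * n * n + 2) + k
      ≤ P * (P ^ 14 * N + P ^ 3 + 2) + P := by gcongr
    _ = P ^ 15 * N + (P ^ 4 + 3 * P) := by ring
    _ ≤ P ^ 15 * N + (P ^ 15 * N + P ^ 15 * N) :=
        Nat.add_le_add_left (Nat.add_le_add h4 (h3P.trans h4)) _
    _ ≤ 4 * (P ^ 15 * N) := by omega
    _ ≤ P ^ 2 * (P ^ 15 * N) := Nat.mul_le_mul_right _ h22
    _ = P ^ 17 * N := by ring

/-- The final degree arithmetic: `P⁶ + B n n ≤ P⁷` for `B, n ≤ P`, `2 ≤ P`. [folklore] -/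
theorem degree_arith {B n P : ℕ} (hB : B ≤ P) (hn : n ≤ P) (h2 : 2 ≤ P) :
    P ^ 6 + B * n * n ≤ P ^ 7 := by
  have hBnn : B * n * n ≤ P ^ 6 :=
    calc B * n * n ≤ P * P * P := Nat.mul_le_mul (Nat.mul_le_mul hB hn) hn
      _ = P ^ 3 := by ring
      _ ≤ P ^ 6 := Nat.pow_le_pow_right (by omega) (by norm_num)
  calc P ^ 6 + B * n * n ≤ P ^ 6 + P ^ 6 := by gcongr
    _ = 2 * P ^ 6 := by ring
    _ ≤ P * P ^ 6 := Nat.mul_le_mul_right _ h2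
    _ = P ^ 7 := by ring

end StubCombClosure

open StubCombClosure

/-- **Registered stub `stub_combClosure` (V5): linear closure of Valiant witnesses.**  From
per-datum witnesses (`datumWitnessSpec`) of `k ≤ B` data bounded by `B`, the combination
`combPoly τ c`, renamed along `topIncl n`, is `boolSum H` for an `H` on the common Boolean block
`Fin (B · n · n)` with `L(H) ≤ (B+n+2)¹⁷ C(2n,n)` and `deg H ≤ (B+n+2)⁷` (`combWitnessSpec`):
pad each block, rename the polynomial variables, take `Σ_i C (c i) · _`.
[cite: Burgisser2000, Prop. 2.20 and Rem. 2.2] -/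
theorem stub_combClosure :
    ∀ (n k : ℕ) (τ : Fin k → TabDatum n) (c : Fin k → ℂ) (B : ℕ), k ≤ B →
      (∀ i, (τ i).Bounded B) → (∀ i, datumWitnessSpec n (τ i) B) → combWitnessSpec n k τ c B := by
  intro n k τ c B hk hB hdat
  choose H hH using hdat
  have hle : ∀ i, (τ i).D * n * n ≤ B * n * n := fun i =>
    Nat.mul_le_mul_right _ (Nat.mul_le_mul_right _ (hB i).1)
  choose G hG using fun i => exists_pad (σ := topMonomials n) (hle i) (H i)
  have hGb : ∀ i, boolSum (G i) = (τ i).poly := fun i => (hG i).1.trans (hH i).1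
  refine ⟨∑ i, C (c i) * rename (Sum.map (topIncl n) id) (G i), ?_, ?_, ?_⟩
  · rw [boolSum_finset_sum]
    simp only [boolSum_C_mul, boolSum_rename_sumMap, hGb, combPoly, map_sum, smul_eq_C_mul,
      map_mul, rename_C]
  · refine (complexity_finset_sum_le _ _).trans ?_
    have hterm : ∀ i ∈ (Finset.univ : Finset (Fin k)),
        complexity (C (c i) * rename (Sum.map (topIncl n) id) (G i)) ≤
          (B + n + 2) ^ 14 * Nat.choose (2 * n) n + B * n * n + 2 := by
      intro i _
      refine (complexity_mul_le_holds _ _).trans ?_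
      rw [complexity_C_holds, zero_add]
      have h1 := complexity_rename_le_holds' (Sum.map (topIncl n) (id : Fin (B * n * n) → _)) (G i)
      have h2 := (hG i).2.1
      have h3 := (hH i).2.1
      omega
    refine (Nat.add_le_add_right (Finset.sum_le_sum hterm) _).trans ?_
    rw [Finset.sum_const, smul_eq_mul, Finset.card_univ, Fintype.card_fin]
    exact size_arith (by omega) (by omega) (by omega) (by omega) (Nat.choose_pos (by omega))
  · refine (totalDegree_finsetSum _ _).trans (Finset.sup_le fun i _ => ?_)
    refine (totalDegree_mul _ _).trans ?_
    rw [totalDegree_C, zero_add]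
    refine (totalDegree_rename_le _ _).trans ((hG i).2.2.trans ?_)
    exact (Nat.add_le_add_right (hH i).2.2 _).trans (degree_arith (by omega) (by omega) (by omega))

end Summit.ValiantsHypothesis.ValiantsHypothesis.Theorems.BarrierLeverDefinableEquations

end
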